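import Mathlib
import HarnessLib
import HarnessLib.Audit
import Summits.Langlands.Statement
import Literature.NumberTheory.DiophantineGeometry.AVGaloisModule
import Literature.NumberTheory.GaloisRepresentations.SymplecticMultiplier
import Literature.NumberTheory.GaloisRepresentations.CrystallineOrdinaryShape
import HarnessLib.Audit.Status.Attr

/-!
Route: RegularSerreAbelianSurfaces

DORMANT since 2026-08-24T02:34:05Z (reconciler: no traction for 6.4 d (last activity item-evidence-added at 2026-08-17T14:58:13Z); parked, not closed — `ledger route dormant route-Langlands-RegularSerreAbelianSurfaces --off` to reactiva) — unstaffed, not closed; items shared with open routes are served there. `ledger route dormant <id> --off` reactivates.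

# Route RegularSerreAbelianSurfaces — regular-weight Serre for GSp4 pays for every abelian surface
over Q (BCGP's printed bridge as the deciding crux)

OPEN-QUESTION HARVEST (lens oqh) on Boxer–Calegari–Gee–Pilloni 2025 (arXiv:2502.20645), §10.4
"Consequences of Serre's
Conjecture in regular weight", Lemma 10.4.1 (p.146 of the held text): "Suppose that for every
residual representation
ρ̄ : G_ℚ → GSp₄(𝔽_p) [with multiplier ε̄⁻¹, absolutely irreducible, ρ̄|_(G_ℚp)^ss a direct sum of
characters] there exists an
ordinary cuspidal automorphic representation π of GSp₄/ℚ of regular weight, level prime to p, and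
central character |·|², such
that ρ̄_(π,p) ≅ ρ̄. Then all abelian surfaces A/ℚ are modular" (Remark 10.4.2: it suffices to demand
this for p sufficiently
large). It suffices to show X = C1 ∧ S1: C1 (OrdinarySerreGSp4) = the printed HYPOTHESIS, typed
through the tree's GL₄ proxy;
S1 (SerreToAbelianSurfaces) = the printed IMPLICATION C1 → Target, where Target
(AbelianSurfacesModular) = every abelian surface
over ℚ with Γ_ℚ-irreducible H¹_ét is modular in the summit's a.e. GL₄ form — the abelian-surface
sector of direction (B), n = 4,
F = ℚ, the first IRREGULAR (Hodge–Tate {0,0,1,1}) sector over ℚ reached without residual-image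
hypotheses. The rest of the
summit is the declared junction SectorComplement. Card realised (its ordinary slice):
kw-induction-fontaine-empty-base.
Lean: `OrdinarySerreGSp4 ∧ SerreToAbelianSurfaces`

## Assembly
Pure logic, certified in glue.lean: `closes (h₁ : OrdinarySerreGSp4) (h₂ : SerreToAbelianSurfaces)
(hC : SectorComplement) :
Langlands := hC (h₂ h₁)` — the printed hypothesis feeds the printed implication, whose conclusion is
literally the antecedent of
the junction. Every hypothesis of closes is a declared crux (C1 rank 2, S1 rank 3, junction rank 9);
the target
AbelianSurfacesModular is derived inside closes as `h₂ h₁`. The Assembly item is `OrdinarySerreGSp4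
→ SerreToAbelianSurfaces →
Langlands` (the chain WITHOUT the junction): the literal type of closes would be a propositional
tautology over the
implication-shaped items (#h21_ground: ground.trivial), so it is not filed as an item — closes is
the certificate.

Rationale: WHY THIS LINE. Khare's trick one dimension up: as odd Artin (irregular, weight one) followed from
Serre's conjecture in REGULAR weight via
weight-lowering (Khare 1997; BCGP §10.4 p.145), BCGP's irregular ordinary classicality theorem
(their Thm 7.x via p-adic
Eichler–Shimura / Sen = Cousin) converts regular-weight residual automorphy for GSp₄ into the
modularity of every abelian surface
over ℚ — the printed Lemma 10.4.1, February 2025, exploited by no route or paper since (lit citing: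
1 unrelated citer). The
deciding crux is therefore a REGULAR-weight, ORDINARY, ABSOLUTELY-IRREDUCIBLE Serre statement for
GSp₄(𝔽_p), p ≫ 0: the one
form of higher-rank Serre for which every engine of Khare–Wintenberger's induction has a printed
GSp₄ analogue (ordinary
automorphy lifting at small residual image BCGP2025 §§7–8 and BoxerEtAl2021, potential automorphy
via families of abelian
surfaces, Fakhruddin–Khare–Patrikis geometric lifts arXiv:1904.02374, Herzig–Tilouine / Gee–Geraghty
Serre weights and
companion forms, prime switching à la BLGGT) and whose induction bottoms out in a THEOREM
(Fontaine1985 / Abrashkin / Schoof: no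
irreducible crystalline ρ̄ of abelian-surface type unramified outside p for p ≤ 7 — the card
kw-induction-fontaine-empty-base).
Imported areas: arithmetic geometry of abelian surfaces (density-one ordinary primes, Serre's open
image), p-adic Hodge theory
through BCGP's classicality, congruences between compatible systems. What prior routes do not do:
PhantomRMYoshida attacks the
absolutely REDUCIBLE (Aschbacher C₃, residually Yoshida) corner by lifting; GSpinCensusRung /
OccultE6Transport / TrigonalHeartLimit
treat special irregular motives by transport; none files the absolutely irreducible Serre statement,
and none consumes BCGP's
printed bridge to ALL abelian surfaces.

RANKED CRUXES. #0 AbelianSurfacesModular (target) — ALL ABELIAN SURFACES OVER ℚ ARE MODULAR (printed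
conclusion of BCGP Lemma 10.4.1), on the sector direction (B) speaks about: for every abelian
surface A/ℚ (tree AbelianVariety ℚ, dim = 2), every ℓ, every ℚ_ℓ-basis b of V_ℓ A and the framed
representation r of Γ_ℚ on H¹_ét(A_ℚ̄, ℚ̄_ℓ) = (V_ℓ A)^∨ ⊗ ℚ̄_ℓ in the dual basis (frame clause
verbatim from the accepted bcgp_switch_exists_modular_abelianSurface), if r is irreducible then for
every level witness and ι there is an L-algebraic cuspidal π on GL₄(𝔸_ℚ) whose Satake parameters
give the arithmetic Frobenius polynomials of r at almost all v. (why it might fail: Nobody expects a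
non-modular abelian surface; as typed the risks are the frame/Satake normalisation (copied from the
accepted BCGP switch fact) and cuspidality on GL₄ for irreducible but imprimitive H¹ (AI of a GL₂
form over a quadratic field is cuspidal iff not Galois-invariant).) [BoxerCalegariGeePilloni2025,
BoxerEtAl2021, GeeTaibi2019, Arthur2013]
#2 OrdinarySerreGSp4 (crux) — PRINTED (BCGP2025 Lemma 10.4.1 hypothesis, in the Remark 10.4.2
variant "p sufficiently large"), through the GL₄ proxy: there is P₀ such that for every prime p ≥
P₀, every algebraically closed k of characteristic p, every reduction map red : 𝒪_(ℚ̄_p) → k and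
every IRREDUCIBLE ρ̄ : Γ_ℚ → GL₄(k), symplectic with multiplier ε̄⁻¹ and triangularisable on Γ_(ℚ_p)
(semisimplification a sum of characters), and every level witness and ι, there are a cuspidal
REGULAR ALGEBRAIC Π on GL₄(𝔸_ℚ) UNRAMIFIED at p and r : Γ_ℚ → GL₄(ℚ̄_p) with: r symplectic for some
multiplier (descends to GSp₄), r Greenberg-ordinary of injective shape at p (ordinary of regular
weight), r = r_(Π,ι) (cofinite Satake–Frobenius matching, arithFrobPolyOfSatake ι q_v 4), and r ≡ ρ̄
(cofinitely the Frobenius characteristic polynomials of r are integral and reduce under red to those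
of ρ̄). [difficulty: open-problem] (why it might fail: It is Serre's conjecture for GSp₄(𝔽_p)
(regular weight, ordinary ρ̄): open, no case with image ⊇ Sp₄(𝔽_p) known (BCGP2025 p.146; p.4 "we do
not know how to do this"); as typed, a level-prime-to-p ordinary form might need a non-injective
shape for 'très ramifiée' ρ̄|_(Γ_ℚp).) [BoxerCalegariGeePilloni2025, KhareWintenberger2009,
arXiv:1904.02374, FakhruddinKharePatrikis2022, BoxerEtAl2021, Serre1987]
#3 SerreToAbelianSurfaces (crux) — PRINTED THEOREM typed fact-free (named-fact gate): BCGP2025 Lemma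
10.4.1 with Remark 10.4.2 and Theorem 10.2.1 — OrdinarySerreGSp4 → AbelianSurfacesModular. The proof
(p.146): Thm 10.2.1 disposes of 32 of the 34 Galois types (Kisin/KW for reducible and E[D_n] types,
Lemma 10.2.5 for potentially abelian irreducible ρ); for the two 'challenging' types (End(A_ℚ̄) = ℤ,
and B[C₂]) a density-one set of primes p makes A ordinary, residually p-distinguished, with ρ̄_(A,p)
vast, tidy and of image GSp₄(𝔽_p) resp. SL₂(𝔽_p) ≀ ℤ/2; the Serre hypothesis supplies π and the
ordinary irregular classicality theorem (their Thm 7.x,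
'rho-is-modular-from-mult-one-and-classicity') does the rest; transfer GSp₄ → GL₄ (Arthur,
Gee–Taïbi) gives the cuspidal L-algebraic π of the target when H¹ is irreducible. [deps:
OrdinarySerreGSp4] [difficulty: L] (why it might fail: Printed proof rests on Arthur's
classification for GSp₄ whose last unpublished input is the twisted weighted fundamental lemma (BCGP
§1.6); and the GL₄ proxy must descend to the printed GSp₄ form (holomorphic packet member,
ordinarity via crystalline compatibility at p).) [BoxerCalegariGeePilloni2025, GeeTaibi2019,
Arthur2013, Mok2014]
#9 SectorComplement (crux) — THE REST OF THE SUMMIT — AbelianSurfacesModular → Langlands with the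
target text INLINED (self-contained; avoids colliding with other routes' `Target → Langlands`
items): every sector other than (n, F) = (4, ℚ)-abelian-surfaces, direction (A), local–global
compatibility at every finite place for these π (Mok2014 up to semisimplification + purity of H¹(A)
forces the generic = unique N + Fontaine's pinned D_pst via C_pst for abelian varieties), the
reciprocity data 𝓡. Conjecture-grade, implied by the summit, never staffed from this route; filed so
that closes ends in the summit constant. [difficulty: open-problem] (why it might fail: It IS the
open reciprocity conjecture for GL_n outside one sector (BuzzardGeeLMS2014 Conj. 3.2.1/3.2.2,
FontaineMazurGeometric1995 Conj. 1); no engine claimed here; implied by the summit; graders judge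
the ranked cruxes.) [BuzzardGeeLMS2014, FontaineMazurGeometric1995, Mok2014, Calegari2023]

TWO-LAYER PLAN. Foreseen glued splits, none filed now. (i) OrdinarySerreGSp4 ⇐ OrdinaryLiftExists
(Fakhruddin–Khare–Patrikis-type symplectic
Greenberg-ordinary lifts of ρ̄, p ≫ 0 — largely in print) → ResidualAutomorphyOfLift (the Serre
core: by ordinary automorphy
lifting for GSp₄ equivalent to the automorphy of ONE ordinary regular lift) → OrdinarySerreGSp4
[this is the BC3 birth skeleton,
composition proved]. (ii) ResidualAutomorphyOfLift ⇐ the Khare–Wintenberger ladder of card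
kw-induction-fontaine-empty-base:
EmptyBase (no irreducible ρ̄ of abelian-surface type unramified outside p, p ∈ {5,7}:
Fontaine–Abrashkin–Schoof, provable from
print) → KillingRamification (prime switching inside compatible systems produced by potential
modularity, BoxerEtAl2021 +
BLGGT) → WeightReduction (θ-cycles / partial Hasse invariants on the Siegel threefold; Yamauchi's
weight reduction for GSp₄).
(iii) SerreToAbelianSurfaces ⇐ QuadraticallySplit (H¹ reducible over a quadratic field: types B[C₂],
E[D_n], induced D/F) →
QuadraticallyPrimitive (type A and primitive potentially-abelian) → SerreToAbelianSurfaces [BC3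
birth skeleton, composition
proved by by_cases].

KILL CRITERIA. A single absolutely irreducible odd-symplectic ρ̄ : Γ_ℚ → GSp₄(𝔽̄_p), triangular at
p, provably NOT congruent to any ordinary
regular-weight level-prime-to-p cuspidal π (e.g. by an effective Serre-weight obstruction) refutes
OrdinarySerreGSp4 as typed:
if the obstruction is the injective-shape / level-prime-to-p clause ('très ramifiée' analogue) the
class is misstated — repair
by allowing level p or a non-injective shape (BCGP's Remark 10.4.2 sanctions variants) and
re-certify; if it is a genuine failure
of residual automorphy the route (and the GSp₄ Serre conjecture) is dead: close
refuted:OrdinarySerreGSp4. SerreToAbelianSurfaces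
refuted as typed (descent GL₄ → GSp₄ or TWFL gap) ⇒ restate with the GSp₄-side hypothesis made
explicit (definition request
below) — pivot, not death. A proof elsewhere of the modularity of all abelian surfaces over ℚ (e.g.
BCGP over totally real fields +
base change) moots the route: close superseded. OrdinarySerreGSp4 proved for images ⊇ Sp₄(𝔽_p) only
already yields type A
(End(A_ℚ̄) = ℤ) — record as a glued split, not a kill.

NOT DECOMPOSED YET. The KW ladder under ResidualAutomorphyOfLift (small-prime ordinary ALTs for GSp₄
at p ∈ {2,3,5,7} in the non-ordinary passages,
weight reduction, killing ramification) — layer-2 children once OrdinaryLiftExists closes; the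
image-class split of
OrdinarySerreGSp4 (⊇ Sp₄(𝔽_p) / imprimitive GL₂ ≀ S₂ / tensor-induced / Sym³ / exceptional A₆, A₇,
2.A₅ classes — each with its own
free anchor, PhantomRMYoshida's route map); local–global compatibility for the abelian-surface π at
every place (Mok2014 +
purity ⇒ generic N; C_pst) — inside the junction; the GL₂-type-over-real-quadratic residue printed
by BCGP p.139 ("remains open in
general even for real quadratic fields") — a LADDER rung (B[C₂] type by automorphic induction), not
consumed by closes, hence not
an item.

CHEAPEST FALSIFIER. (1) Consistency on the modular locus (refuter, literature only): for a modular
abelian surface A/ℚ of type A, ordinary at p with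
ρ̄_(A,p) surjective (e.g. LMFDB genus-2 curve 277.a, paramodular; p = 5 or 7), Hida theory for GSp₄
(Tilouine–Urban, Pilloni)
must produce the regular-weight ordinary level-prime-to-p π of the crux with ρ̄_(π,p) ≅ ρ̄_(A,p) —
if the typed clauses (injective
Greenberg shape, unramified at p, symplectic r, HLTT normalisation arithFrobPolyOfSatake ι q 4)
cannot all be met THERE, the crux
is misstated. (2) `lit citing arxiv:2502.20645` for a 2025–26 proof of regular-weight Serre for GSp₄
or of all abelian surfaces
(run here: local graph 1 unrelated citer; APIs rate-limited — refuter should re-run). (3) The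
empty-base lemma at p = 5
(Fontaine–Abrashkin bound 5^(1+3/4) ≈ 16.7 < Odlyzko) as an in-print check that the KW ladder has a
floor.

NUMBERS. BCGP2025 Thm 1.1 applies to 11743 of 66158 LMFDB genus-2 curves (≈ 11.9 % of all genus-2
curves by local densities 5551/46656);
Thm 10.2.1: 32 of 34 Sato–Tate Galois types modular unconditionally; challenging types: A (End = ℤ,
density one) and B[C₂].
Lemma 10.4.1 uses p in a density-one set per A (ordinary + p-distinguished + vast/tidy + image
GSp₄(𝔽_p), p > 5 for the
regular-semisimple element (diag(1,6),diag(2,3))). |GSp₄(𝔽₃)| = 103680. KW empty base: root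
discriminant < p^(1+3/(p−1)) = 16.7
(p = 5), 18.5 (p = 7) < Odlyzko 22.3. Items at open: 5 (target, 3 cruxes incl. junction, assembly) ≤
15.

DEFINITION REQUESTS. Cite fact wanted (filed after open as --kind cite):
`Literature.NumberTheory.DiophantineGeometry.bcgp_serreRegularWeight_implies_allAbelianSurfacesModular`
— BoxerCalegariGeePilloni2025 Lemma 10.4.1 + Remark 10.4.2 + Thm 10.2.1, in the typed form
`OrdinarySerreGSp4 → AbelianSurfacesModular` of this route (closes S1 by `exact`). Notion wanted
(optional, would remove the GL₄ proxy): `CuspidalSiegelEigenformGSp4` (holomorphic cuspidal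
automorphic representation of GSp₄/ℚ of weight (k₁,k₂), level, central character, ordinarity at p;
topic Literature/NumberTheory/Automorphic) with the transfer fact to GL₄ (GeeTaibi2019, Arthur2013).

Novelty: Searches (2026-08-17): corpus frontier.json (60 rows since 2023) + reads.jsonl (5) + galaxy.json
(30); page-level reads: arXiv:2607.11763 pp.1–8,111–112; arXiv:2605.03519 pp.1–4; arXiv:2502.20645
pp.3–6,138–146; arXiv:2603.19768 pp.1–3 (+hits p.6,11,22); arXiv:2301.10509 pp.1–3; arXiv:2602.16452
p.1–2; arXiv:2502.10799 hit p.12; `lit citing arxiv:2502.20645` (local graph: 1 citer,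
arXiv:2507.07423 Drinfeld higher Hida — unrelated; API 429); `lit galaxy search "Serre's conjecture
for GSp(4)" --star all` (0), `"Serre weight conjectures for GSp4"` (0), `"Serre weights GSp4"` (0),
`"mod p Siegel modular forms Serre" --star pdf` (0); `lit search --hybrid "Serre-type conjecture for
GSp4 residual modularity weight"` (10 book hits, none a proof); `lit search --source
zbmath/openalex/arxiv` rate-limited (0/429); `lean search` (IsGreenbergOrdinaryOfShapeAt,
IsSymplecticWithMultiplierFun, bcgp_switch_exists_modular_abelianSurface, AHTW2026LocalGlobalAtP);
`ledger negatives --problem Langlands` (3, none related); the 50 open route heads + cards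
kw-induction-fontaine-empty-base, phantom-real-multiplication (closed), golden-field-serre-ladder,
fontaine-void-kw-ladder (closed).
Nearest prior art found: BoxerCalegariGeePilloni2025 §10.4 Lemma 10.4.1 / Rem. 10.4.2 (the printed
implication itself; the authors stop there: p.4 "Deducing residual modularity in irregular weight
from regular weight would be a higher dimensional analogue of … weight one, and we do not know how
to do this", p.146 "It  [refs: 2607.11763, 2605.03519, 2502.20645, 2603.19768, 2301.10509, 2602.16452, 2502.10799, 2507.07423, arxiv:2502.20645, BoxerCalegariGeePilloni2025, KhareWintenberger2009]

Barriers (technique_class: serre-conjecture automorphy-lifting congruences classicality): - technique_class: serre-conjecture automorphy-lifting congruences classicality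
- Literature.Barriers.Langlands.NonRegularWeightBarrier: EVADED BY DESIGN — the irregular sector
(weight (2,2), HT {0,0,1,1}) is never attacked in irregular weight: the crux lives in REGULAR weight
and BCGP's ordinary irregular classicality (Sen = Cousin on the Siegel threefold, completed
cohomology + higher Coleman theory) carries it down; the barrier's hypothesis (constructing /
lifting in non-cohomological weight by cohomological means) is not met.
- Literature.Barriers.Langlands.NonRegularWeightBarrierNarrow: escaping hypothesis named — nothing
here reads r_(π,ι) off H^*(X_K, V_λ) at an irregular λ: the regular-weight crux uses cohomological
realisation legitimately (λ regular), and the descent to weight (2,2) is BCGP's p-adic interpolation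
/ completed-cohomology classicality, which the Narrow barrier explicitly exempts ("NOT p-adic
interpolation, eigenvarieties, completed cohomology").
- Literature.Barriers.Langlands.ResiduallyReducibleBarrier: not engaged — ρ̄ is absolutely
irreducible in OrdinarySerreGSp4; the reducible Galois types sit inside the printed Thm 10.2.1
(Kisin / Khare–Wintenberger over ℚ) consumed by SerreToAbelianSurfaces.
- Literature.Barriers.Langlands.ResiduallyReducibleBarrierNarrow: idem — no Taylor–Wiles system is
run at a reducible ρ̄ by this route; the KW ladder's terminal step is NON-existence (empty base),
not lifting at ρ̄^ss = ⊕ ω^a.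
- Literature.Barriers.Langlands

History (route lifecycle, newest last):
- 2026-08-24T02:34:05Z · DORMANT — reconciler: no traction for 6.4 d (last activity item-evidence-added at 2026-08-17T14:58:13Z); parked, not closed — `ledger route dormant route-Langlands-Regula (operator:999:1871426)

sub-problem: Langlands · status: dormant · opened planner-plan-lens3-Langlands-oqh-0 2026-08-17T02:01:40Z · rev 1 · ledger route-Langlands-RegularSerreAbelianSurfaces
GENERATED by the gate from the ledger (D-0016/17). Provers cite these decls: `theorem foo : Summit.Langlands.Langlands.Theses.RegularSerreAbelianSurfaces.<Decl> := …` in Summits/Langlands/Langlands/Theorems/<Name>.lean.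
-/

namespace Summit.Langlands.Langlands.Theses.RegularSerreAbelianSurfaces

open scoped BigOperators Topology Manifold Classical MeasureTheory ProbabilityTheory Matrix InnerProductSpace ComplexConjugate ContinuousMap
open Filter Set Function TopologicalSpace MeasureTheory

attribute [summit_statement] _root_.Langlands

/-- item stmt-Langlands-17568 · target · rank 0 · open · by planner
why it might fail: Nobody expects a non-modular abelian surface; as typed the risks are the frame/Satake normalisation (copied from the accepted BCGP switch fact) and cuspidality on GL₄ for irreducible but imprimitive H¹ (AI of a GL₂ form over a quadratic field is cuspidal iff not Galois-invariant).
sources: BoxerCalegariGeePilloni2025, BoxerEtAl2021, GeeTaibi2019, Arthur2013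
[target] ALL ABELIAN SURFACES OVER ℚ ARE MODULAR (printed conclusion of BCGP Lemma 10.4.1), on the
sector direction (B) speaks about: for every abelian surface A/ℚ (tree AbelianVariety ℚ, dim = 2),
every ℓ, every ℚ_ℓ-basis b of V_ℓ A and the framed representation r of Γ_ℚ on H¹_ét(A_ℚ̄, ℚ̄_ℓ) =
(V_ℓ A)^∨ ⊗ ℚ̄_ℓ in the dual basis (frame clause verbatim from the accepted
bcgp_switch_exists_modular_abelianSurface), if r is irreducible then for every level witness and ι
there is an L-algebraic cuspidal π on GL₄(𝔸_ℚ) whose Satake parameters give the arithmetic Frobenius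
polynomials of r at almost all v. -/
@[route_item "route-Langlands-RegularSerreAbelianSurfaces"]
def AbelianSurfacesModular : Prop :=
  ∀ (A : Literature.AlgebraicGeometry.Motives.AbelianVariety ℚ), A.dim = 2 → ∀ (ℓ : ℕ) [Fact ℓ.Prime] (b : Module.Basis (Fin 4) (Padic ℓ) (A.rationalTateModule ℓ)) (r : Literature.NumberTheory.GaloisRepresentations.FramedGaloisRep ℚ (PadicAlgCl ℓ) 4), (∀ g : Field.absoluteGaloisGroup ℚ, (r g).val = ((LinearMap.toMatrix b b (A.rationalTateRep ℓ g⁻¹)).map (algebraMap (Padic ℓ) (PadicAlgCl ℓ))).transpose) → r.toGaloisRep.IsIrreducible → ∀ (hcpt : Literature.NumberTheory.Automorphic.isCompact_glFiniteIntegralLevel 4 ℚ) (ι : PadicAlgCl ℓ ≃+* ℂ), ∃ π : Literature.NumberTheory.Automorphic.CuspidalAutomorphicRepData 4 ℚ hcpt, π.1.IsLAlgebraic ∧ ∀ᶠ v : IsDedekindDomain.HeightOneSpectrum (NumberField.RingOfIntegers ℚ) in Filter.cofinite, ∃ a : Multiset ℂ, π.1.HasSatakeParamAt v a ∧ r.IsUnramifiedAt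 v ∧ r.HasFrobCharpolyAt v (Literature.NumberTheory.Automorphic.arithFrobPolyOfSatake ι v.residueCard 1 a)

/-- item stmt-Langlands-17569 · crux · rank 2 · open · by planner
why it might fail: It is Serre's conjecture for GSp₄(𝔽_p) (regular weight, ordinary ρ̄): open, no case with image ⊇ Sp₄(𝔽_p) known (BCGP2025 p.146; p.4 "we do not know how to do this"); as typed, a level-prime-to-p ordinary form might need a non-injective shape for 'très ramifiée' ρ̄|_(Γ_ℚp).
sources: BoxerCalegariGeePilloni2025, KhareWintenberger2009, arXiv:1904.02374, FakhruddinKharePatrikis2022, BoxerEtAl2021, Serre1987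
[crux] PRINTED (BCGP2025 Lemma 10.4.1 hypothesis, in the Remark 10.4.2 variant "p sufficiently
large"), through the GL₄ proxy: there is P₀ such that for every prime p ≥ P₀, every algebraically
closed k of characteristic p, every reduction map red : 𝒪_(ℚ̄_p) → k and every IRREDUCIBLE ρ̄ : Γ_ℚ
→ GL₄(k), symplectic with multiplier ε̄⁻¹ and triangularisable on Γ_(ℚ_p) (semisimplification a sum
of characters), and every level witness and ι, there are a cuspidal REGULAR ALGEBRAIC Π on GL₄(𝔸_ℚ)
UNRAMIFIED at p and r : Γ_ℚ → GL₄(ℚ̄_p) with: r symplectic for some multiplier (descends to GSp₄), r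
Greenberg-ordinary of injective shape at p (ordinary of regular weight), r = r_(Π,ι) (cofinite
Satake–Frobenius matching, arithFrobPolyOfSatake ι q_v 4), and r ≡ ρ̄ (cofinitely the Frobenius
characteristic polynomials of r are integral and reduce under red to those of ρ̄). [difficulty:
open-problem] -/
@[route_item "route-Langlands-RegularSerreAbelianSurfaces", crux]
def OrdinarySerreGSp4 : Prop :=
  ∃ P₀ : ℕ, ∀ (p : ℕ) [Fact p.Prime], P₀ ≤ p → ∀ (k : Type) [Field k] [CharP k p] [IsAlgClosed k] [TopologicalSpace k] [DiscreteTopology k] (red : Valued.integer (PadicAlgCl p) →+* k) (ρb : Literature.NumberTheory.GaloisRepresentations.FramedGaloisRep ℚ k 4), ρb.toGaloisRep.IsIrreducible → ρb.IsSymplecticWithMultiplierFun (fun g => (((Units.map (ZMod.castHom (dvd_refl p) k).toMonoidHom ((modularCyclotomicCharacter (AlgebraicClosure ℚ) (HasEnoughRootsOfUnity.natCard_rootsOfUnity (AlgebraicClosure ℚ) p)).comp (MulSemiringAction.toRingAut (Field.absoluteGaloisGroup ℚ) (AlgebraicClosure ℚ)) g))⁻¹ : kˣ) : k)) → (∀ v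 : IsDedekindDomain.HeightOneSpectrum (NumberField.RingOfIntegers ℚ), ((p : ℕ) : NumberField.RingOfIntegers ℚ) ∈ v.asIdeal → ∃ g : Matrix.GeneralLinearGroup (Fin 4) k, ∀ (τ : Field.absoluteGaloisGroup (v.adicCompletion ℚ)) (i j : Fin 4), j < i → (g * ρb.toLocal v τ * g⁻¹).val i j = 0) → ∀ (hcpt : Literature.NumberTheory.Automorphic.isCompact_glFiniteIntegralLevel 4 ℚ) (ι : PadicAlgCl p ≃+* ℂ), ∃ (π : Literature.NumberTheory.Automorphic.CuspidalAutomorphicRepData 4 ℚ hcpt) (r : Literature.NumberTheory.GaloisRepresentations.FramedGaloisRep ℚ (PadicAlgCl p) 4), π.1.IsRegularAlgebraic ∧ (∀ v : IsDedekindDomain.HeightOneSpectrum (NumberField.RingOfIntegers ℚ), ((p : ℕ) : NumberField.RingOfIntegers ℚ) ∈ v.asIdeal → π.1.IsUnramifiedAt v) ∧ (∃ μ : Field.absoluteGaloisGroup ℚ → PadicAlgCl p, r.IsSymplecticWithMultiplierFun μ) ∧ (∀ v : IsDedekindDomain.HeightOneSpectrum (NumberField.RingOfIntegers ℚ), ((p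 : ℕ) : NumberField.RingOfIntegers ℚ) ∈ v.asIdeal → ∃ a : Fin 4 → ℕ, Function.Injective a ∧ r.IsGreenbergOrdinaryOfShapeAt v a) ∧ (∀ᶠ v : IsDedekindDomain.HeightOneSpectrum (NumberField.RingOfIntegers ℚ) in Filter.cofinite, ∃ α : Multiset ℂ, π.1.HasSatakeParamAt v α ∧ r.IsUnramifiedAt v ∧ r.HasFrobCharpolyAt v (Literature.NumberTheory.Automorphic.arithFrobPolyOfSatake ι v.residueCard 4 α)) ∧ (∀ᶠ v : IsDedekindDomain.HeightOneSpectrum (NumberField.RingOfIntegers ℚ) in Filter.cofinite, r.IsUnramifiedAt v ∧ ρb.IsUnramifiedAt v ∧ ∃ (P : Polynomial (Valued.integer (PadicAlgCl p))) (Pb : Polynomial k), r.HasFrobCharpolyAt v (P.map (Valued.integer (PadicAlgCl p)).subtype) ∧ ρb.HasFrobCharpolyAt v Pb ∧ P.map red = Pb)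

/-- item stmt-Langlands-17570 · crux · rank 3 · open · by planner
why it might fail: Printed proof rests on Arthur's classification for GSp₄ whose last unpublished input is the twisted weighted fundamental lemma (BCGP §1.6); and the GL₄ proxy must descend to the printed GSp₄ form (holomorphic packet member, ordinarity via crystalline compatibility at p).
sources: BoxerCalegariGeePilloni2025, GeeTaibi2019, Arthur2013, Mok2014
[crux] PRINTED THEOREM typed fact-free (named-fact gate): BCGP2025 Lemma 10.4.1 with Remark 10.4.2
and Theorem 10.2.1 — OrdinarySerreGSp4 → AbelianSurfacesModular. The proof (p.146): Thm 10.2.1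
disposes of 32 of the 34 Galois types (Kisin/KW for reducible and E[D_n] types, Lemma 10.2.5 for
potentially abelian irreducible ρ); for the two 'challenging' types (End(A_ℚ̄) = ℤ, and B[C₂]) a
density-one set of primes p makes A ordinary, residually p-distinguished, with ρ̄_(A,p) vast, tidy
and of image GSp₄(𝔽_p) resp. SL₂(𝔽_p) ≀ ℤ/2; the Serre hypothesis supplies π and the ordinary
irregular classicality theorem (their Thm 7.x, 'rho-is-modular-from-mult-one-and-classicity') does
the rest; transfer GSp₄ → GL₄ (Arthur, Gee–Taïbi) gives the cuspidal L-algebraic π of the target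
when H¹ is irreducible. [deps: OrdinarySerreGSp4] [difficulty: L] -/
@[route_item "route-Langlands-RegularSerreAbelianSurfaces", crux]
def SerreToAbelianSurfaces : Prop :=
  OrdinarySerreGSp4 → AbelianSurfacesModular

/-- item stmt-Langlands-17571 · crux · rank 9 · open · by planner
why it might fail: It IS the open reciprocity conjecture for GL_n outside one sector (BuzzardGeeLMS2014 Conj. 3.2.1/3.2.2, FontaineMazurGeometric1995 Conj. 1); no engine claimed here; implied by the summit; graders judge the ranked cruxes.
sources: BuzzardGeeLMS2014, FontaineMazurGeometric1995, Mok2014, Calegari2023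
[crux] THE REST OF THE SUMMIT — AbelianSurfacesModular → Langlands with the target text INLINED
(self-contained; avoids colliding with other routes' `Target → Langlands` items): every sector other
than (n, F) = (4, ℚ)-abelian-surfaces, direction (A), local–global compatibility at every finite
place for these π (Mok2014 up to semisimplification + purity of H¹(A) forces the generic = unique N
+ Fontaine's pinned D_pst via C_pst for abelian varieties), the reciprocity data 𝓡.
Conjecture-grade, implied by the summit, never staffed from this route; filed so that closes ends in
the summit constant. [difficulty: open-problem] -/
@[route_item "route-Langlands-RegularSerreAbelianSurfaces", crux]
def SectorComplement : Prop :=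
  (∀ (A : Literature.AlgebraicGeometry.Motives.AbelianVariety ℚ), A.dim = 2 → ∀ (ℓ : ℕ) [Fact ℓ.Prime] (b : Module.Basis (Fin 4) (Padic ℓ) (A.rationalTateModule ℓ)) (r : Literature.NumberTheory.GaloisRepresentations.FramedGaloisRep ℚ (PadicAlgCl ℓ) 4), (∀ g : Field.absoluteGaloisGroup ℚ, (r g).val = ((LinearMap.toMatrix b b (A.rationalTateRep ℓ g⁻¹)).map (algebraMap (Padic ℓ) (PadicAlgCl ℓ))).transpose) → r.toGaloisRep.IsIrreducible → ∀ (hcpt : Literature.NumberTheory.Automorphic.isCompact_glFiniteIntegralLevel 4 ℚ) (ι : PadicAlgCl ℓ ≃+* ℂ), ∃ π : Literature.NumberTheory.Automorphic.CuspidalAutomorphicRepData 4 ℚ hcpt, π.1.IsLAlgebraic ∧ ∀ᶠ v : IsDedekindDomain.HeightOneSpectrum (NumberField.RingOfIntegers ℚ) in Filter.cofinite, ∃ a : Multiset ℂ, π.1.HasSatakeParamAt v a ∧ r.IsUnramifiedAt v ∧ r.HasFrobCharpolyAt v (Literature.NumberTheory.Automorphic.arithFrobPolyOfSatake ι v.residueCard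 1 a)) → _root_.Langlands

/-- item stmt-Langlands-17572 · assembly · rank 1 · open · by planner
sources: BoxerCalegariGeePilloni2025, BuzzardGeeLMS2014
[assembly] OrdinarySerreGSp4 → SerreToAbelianSurfaces → Langlands — the route's standing claim "the
two printed items suffice", i.e. the junction's content with the target eliminated (implied by
SectorComplement; deliberately NOT the literal type of closes, which would be a propositional
tautology over the implication-shaped items S1 := C1 → Target and SectorComplement := Target →
Langlands, flagged ground.trivial by #h21_ground). -/
@[route_item "route-Langlands-RegularSerreAbelianSurfaces"]
def Assembly : Prop :=
  OrdinarySerreGSp4 → SerreToAbelianSurfaces → _root_.Langlands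

/-! D-0027 §2.1 — DECIDING THEOREM (planner-authored via `route open/edit --closes-file`; by planner-plan-lens3-Langlands-oqh-0 2026-08-17T02:01:40Z):
its hypotheses are this route's items and its conclusion the sub-problem Statement (glue_lint), and it elaborates with this file. -/

@[closes "route-Langlands-RegularSerreAbelianSurfaces"] theorem closes (h₁ : OrdinarySerreGSp4) (h₂ : SerreToAbelianSurfaces) (hC : SectorComplement) :
    _root_.Langlands :=
  hC (h₂ h₁)

end Summit.Langlands.Langlands.Theses.RegularSerreAbelianSurfaces
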